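import Summits.QuantumFields.YangMills.Theorems.UnitScaleTiltProp7TiledCubeMemberKnit
import Summits.QuantumFields.YangMills.Theorems.UnitScaleTiltProp7CombVsAxialMeansMember
import Summits.QuantumFields.YangMills.Theorems.UnitScaleTiltProp7BoxLocalPotentialMember
import HarnessLib

/-!
# Route `UnitScaleTilt`, crux K1 «MinimiserStabilityRegPr» (stmt-QuantumFields-19200) — route-R E′ (A′), LANE II «DIVERGENCE RECOVERY AT CURVED `W`» (★★OWNER RULING №23),
# (B7) [I-5] (a′) «THE MEMBER READING OF (B9d)», FILE 3∕3 — **THE KNIT, STAGE B: `h7 ⊕ h8` OF ✓`patch_budget` AT THE MEMBER.  The coarse term of stage A (squared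
# differences of the AXIAL block means of `φ_Z` over the inner coarse bonds of the tiled box) is `η⁻²` times px5's currency `Σ‖Y_q‖²` for the pull-back
# `φ♭ = toL2S⁻¹φ ∘ transl basePt` (the comb blocks of ✓`QprimeCombL2_apply` live in the base chart `basePt`, so the knit is stated there); px5's
# ✓∕⧗`Prop7CombVsAxialMeansMember.sum_sq_grad_conv_of_regPr` converts it on `RegPr` into the `Ū`-differences of the comb averages `Q′_kφ♭` plus `e²`-costs, and
# ✓`QprimeIter_pullS_eq_apply_tcls` ∕ ✓`shift_transl_eq` ∕ ✓`transl_zero_eq_tcls` read those on the torus as `Ad(T ĉ)(Q′φ)(ĉ₊) − (Q′φ)(ĉ.src)`, `Q′φ := QprimeCombL2 W φ`:**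
# `Φt ≤ 8·‖D_Wφ‖² + 32ℓ²(2dR_fα)²d·‖φ‖² + 32c_m·(c₀ℓ^d·Σ_{ĉ ∈ ι(C)}‖Ad(T ĉ)(Q′φ)(ĉ₊) − (Q′φ)(ĉ.src)‖²) + 64c_m·d·(γ′² + γ²)·‖φ‖²`
# (`Φt := c₀Σ_{w ∈ box z R_f}hs(φ♭(basePt + w))`, `c_m = m(m+1)∕2`, `γ′ = (2CT + 48(m+1) + 29232)e`, `γ = (29232 + 36(m+1))e`; with the radii of record `m = 4R+2` and
# (P-box)'s `α = e·η²` this is `h7 : Φt ≤ CP·(Gφ + e²Φ) + Nt`, `h8 : Nt ≤ C9·R²·Gc + C9′·R⁴·e²·Φ` with `CP = 8` and `Gc` the radius-`(2R+1)` coarse sum).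

Cell `ym3-torus` ∕ width seat `ym3-torus-px9` (gen 7, «width 9»).  THEOREMS ONLY (0 `def`, 0 `sorry`); `--supports stmt-QuantumFields-19200 --as helper`, count-neutral.
YM₃ on T³ is a ladder rung (R3), not d = 4, not the Clay problem; nothing here claims (B7), (REC), `hN06`, E′, EX or the gap.

WHAT IS PROVED (ns `…Theorems.Prop7TiledCubeMemberH7H8`): ★ `sum_le_boxSum_of_chart` (the `h6 ↔ h7` junction: any chart-point set is paid by `Φt`) · ★ `blockMean_pull_eq` · ★★ `sum_normSq_axialDiff_eq` (`Σ_C‖Y‖² = η²·DIFF`) · `sum_blocks_normSq_pull_eq` ·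
`sum_C_src_le` ∕ `sum_C_tgt_le` (multiplicity `d`) · ★★ `sum_C_normSq_combDiff_eq` (the `ℤ³` sum read on the torus, injective on the cube since `m + 1 ≤ N_{K−n}`) ·
★★★ `h7h8_core` (`ℤ³` letters) · ★★★ `h7h8_member` (torus letters).
HONEST SCOPE.  Bookkeeping over landed∕pending rows (px4 (B9d), px5 [I-5-conv], px12 (T-box)); nothing of (B7)∕(REC)∕`hN06`∕the crux is asserted; rung R3, not Clay;
YM gap NOT proved.

References: T. Bałaban, CMP 98 (1985) 17–51 [Balaban1985Averaging] (pp.24–25); T. Bałaban, CMP 99 (1985) 389–434 [Balaban1985BackgroundPropagators] ((3.19) p.393,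
(3.24)–(3.26) pp.394–395, (3.100) p.413); T. Bałaban, CMP 99 (1985) 75–102 [Balaban1985RegularSpaces] ((1.3) p.77: the torus classes); [folklore].
-/

set_option autoImplicit false

open scoped BigOperators Matrix.Norms.L2Operator

namespace Summit.QuantumFields.YangMills.Theorems.Prop7TiledCubeMemberH7H8

open Literature.MathematicalPhysics.QuantumFieldTheory.Balaban1983to89
open Literature.MathematicalPhysics.QuantumFieldTheory.Balaban1983to89.T3ContinuumYM3Torus
open Literature.MathematicalPhysics.QuantumFieldTheory.Balaban1983to89.T3PrintedRegularMinimiser (RegPr)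
open Literature.MathematicalPhysics.QuantumFieldTheory.Balaban1983to89.B4Eq19LatticeOperators (Zd box unitVec mem_box)
open Literature.MathematicalPhysics.QuantumLattice (blockMap blockBase blockSites)
open B10Eq27TorusAxialLog (transl pull pull_apply holT unitsField toUField)
open B7Prop1Explicit (axialFn U1 e)
open B7Prop2Explicit (C0 c2')
open B7Eq78Linearization (conjR QprimeIter zdBlocking)
open B8Eq119TwistedAxial (bgT)
open B9B8AveragingKernelZd (blockIter)
open T4TermwiseTorus (tlift)
open T3SectALandauChart (eta eta_pos bgUnits)
open B11Eq103H1Complex (SiteL2K BondL2K)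
open Summit.QuantumFields.YangMills.Theorems.Prop7SectET3Transport (periodsT3)
open Summit.QuantumFields.YangMills.Theorems.Prop7SectET3HilbertLetters (W₂ toL2 toL2S DL2)
open Summit.QuantumFields.YangMills.Theorems.Prop7SPrint (basePt)
open Summit.QuantumFields.YangMills.Theorems.Prop7QprimeCombL2 (QprimeCombL2 QprimeIter_pullS_eq_apply_tcls)
open Summit.QuantumFields.YangMills.Theorems.Prop7QprimeCombBumpSectionRows (shift_transl_eq transl_zero_eq_tcls)
open Summit.QuantumFields.YangMills.Theorems.Prop7BoxChartTransport (transl_eq_transl_iff transl_injOn_box)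
open Summit.QuantumFields.YangMills.Theorems.Prop7LatticeTiledCube (blk_subset_tiled sum_tiled_eq_sum_blocks)
open Summit.QuantumFields.YangMills.Theorems.Prop7TiledCubeMemberRows (eta_sq_sum_opNorm_sq_le_norm_sq)
open Summit.QuantumFields.YangMills.Theorems.Prop7CombVsAxialMeansMember (sum_sq_grad_conv_of_regPr)
open Summit.QuantumFields.YangMills.Theorems.Prop7TiledCubeMemberKnit (knitA blockIter_eq_blk e_eq_unitVec weight_eq tiled_eq_box_of succ_le_sitesPerDir_of knitB_arith)
open Summit.QuantumFields.YangMills.Theorems.Prop7BoxLocalPotentialMember (conjR_real_smul)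

variable (F : T3Family) (n K : ℕ) (c₀ : ℝ) [Fact (0 < c₀)]

/-! ## §0 The `Φt` letter: any set of chart points is paid by the box sum -/

/-- ★ **THE JUNCTION `h6 ↔ h7`**: for a nonnegative site functional `f` and any finset `S` of sites each of which is a chart point of `box z R` (`2R + 1 ≤ N₀`, e.g. by
✓`exists_mem_blockBox_of_dist_lt`), `Σ_{x ∈ S} f x ≤ Σ_{w ∈ box z R} f (transl c₀ w)` — so (R1)'s local mass on the transition set (px11's `S`) is `≤ Φt` of `h7h8_member`
(take `f x := c₀·hs(toL2S⁻¹φ x)` or pull `c₀` out). [cite: Balaban1985BackgroundPropagators, (3.100) p.413] -/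
theorem sum_le_boxSum_of_chart (c₀ : Site (F.P K) 0) {z : Zd (F.P K).d} {R : ℤ} (hRN : 2 * R + 1 ≤ ((F.P K).sitesPerDir 0 : ℤ))
    (f : Site (F.P K) 0 → ℝ) (hf : ∀ x, 0 ≤ f x) (S : Finset (Site (F.P K) 0)) (hS : ∀ x ∈ S, ∃ w ∈ box z R, transl c₀ w = x) :
    ∑ x ∈ S, f x ≤ ∑ w ∈ box z R, f (transl c₀ w) := by
  classical
  rw [← Finset.sum_image fun w₁ h₁ w₂ h₂ h => transl_injOn_box c₀ hRN h₁ h₂ h]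
  exact Finset.sum_le_sum_of_subset_of_nonneg
    (fun x hx => by obtain ⟨w, hw, rfl⟩ := hS x hx; exact Finset.mem_image.mpr ⟨w, hw, rfl⟩) fun x _ _ => hf x

/-! ## §1 The currency identity and the multiplicities -/

omit [Fact (0 < c₀)] in
/-- ★ THE AXIAL BLOCK MEAN OF THE PULL-BACK IS `η` TIMES THAT OF THE CHART FUNCTION: on a block inside the box,
`Σ_{blockIter b} ω•Ad(u x)(φ♭(basePt + x)) = η • ((ℓ^d)⁻¹ • Σ_{Blk b} Ad(u x)(φ_Z x))`. -/
theorem blockMean_pull_eq (V : Zd (F.P K).d → Fin (F.P K).d → (Matrix (Fin 2) (Fin 2) ℂ)ˣ) (lo : Zd (F.P K).d)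
    {z : Zd (F.P K).d} {Rf : ℤ} (φ : SiteL2K ℂ 3 (periodsT3 F K) c₀ W₂) (φZ : Zd (F.P K).d → Matrix (Fin 2) (Fin 2) ℂ)
    (hφZ : ∀ w ∈ box z Rf, (toL2S F K c₀).symm φ (transl (basePt F n K) w) = (eta F n K) • φZ w)
    (b : Zd (F.P K).d)
    (hb : Fintype.piFinset (fun i => Finset.Icc (((F.L ^ (K - n) : ℕ) : ℤ) * b i) (((F.L ^ (K - n) : ℕ) : ℤ) * b i + ((F.L ^ (K - n) - 1 : ℕ) : ℤ))) ⊆ box z Rf) :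
    ∑ x ∈ blockIter (F.P K).L (K - n) b, (((((F.P K).L : ℝ) ^ (F.P K).d)⁻¹) ^ (K - n)) • conjR (axialFn V lo x) ((toL2S F K c₀).symm φ (transl (basePt F n K) x))
      = (eta F n K) • (((((F.L ^ (K - n)) ^ (F.P K).d : ℕ) : ℝ) : ℂ)⁻¹ •
          ∑ x ∈ Fintype.piFinset (fun i => Finset.Icc (((F.L ^ (K - n) : ℕ) : ℤ) * b i) (((F.L ^ (K - n) : ℕ) : ℤ) * b i + ((F.L ^ (K - n) - 1 : ℕ) : ℤ))),
            conjR (axialFn V lo x) (φZ x)) := by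
  rw [blockIter_eq_blk, Finset.smul_sum, Finset.smul_sum]
  refine Finset.sum_congr rfl fun x hx => ?_
  rw [hφZ x (hb hx), conjR_real_smul, weight_eq, smul_comm]
  congr 1
  have hrs : ∀ (r : ℝ) (A : Matrix (Fin 2) (Fin 2) ℂ), r • A = (r : ℂ) • A := fun r A => by
    ext i j; simp only [Matrix.smul_apply, Complex.real_smul, smul_eq_mul]
  rw [hrs, Complex.ofReal_inv]

omit [Fact (0 < c₀)] in
/-- ★★ THE COARSE CURRENCY OF (B9d) IS `η⁻²` TIMES px5's: `Σ_{q ∈ C}‖Y_q‖² = η²·DIFF` (`C` = inner coarse bonds of the tiled cube, `Y_q` the difference of the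
AXIAL block means of the pull-back `φ♭`, `DIFF` the (B9d) double sum over the chart function `φ_Z`). -/
theorem sum_normSq_axialDiff_eq (V : Zd (F.P K).d → Fin (F.P K).d → (Matrix (Fin 2) (Fin 2) ℂ)ˣ) (lo5 : Zd (F.P K).d)
    {z : Zd (F.P K).d} {Rf : ℤ} (lo : Zd (F.P K).d) (m : ℕ)
    (hzlo : ∀ i, z i - Rf = ((F.L ^ (K - n) : ℕ) : ℤ) * lo i)
    (hzhi : ∀ i, z i + Rf = ((F.L ^ (K - n) : ℕ) : ℤ) * lo i + (((m + 1) * F.L ^ (K - n) - 1 : ℕ) : ℤ))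
    (φ : SiteL2K ℂ 3 (periodsT3 F K) c₀ W₂) (φZ : Zd (F.P K).d → Matrix (Fin 2) (Fin 2) ℂ)
    (hφZ : ∀ w ∈ box z Rf, (toL2S F K c₀).symm φ (transl (basePt F n K) w) = (eta F n K) • φZ w) :
    ∑ q ∈ ((Fintype.piFinset (fun i => Finset.Icc (lo i) (lo i + m))) ×ˢ (Finset.univ : Finset (Fin (F.P K).d))).filter
        (fun q => q.1 + e q.2 ∈ Fintype.piFinset (fun i => Finset.Icc (lo i) (lo i + m))),
      ‖∑ x ∈ blockIter (F.P K).L (K - n) (q.1 + e q.2), (((((F.P K).L : ℝ) ^ (F.P K).d)⁻¹) ^ (K - n)) •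
            conjR (axialFn V lo5 x) ((toL2S F K c₀).symm φ (transl (basePt F n K) x))
        - ∑ x ∈ blockIter (F.P K).L (K - n) q.1, (((((F.P K).L : ℝ) ^ (F.P K).d)⁻¹) ^ (K - n)) •
            conjR (axialFn V lo5 x) ((toL2S F K c₀).symm φ (transl (basePt F n K) x))‖ ^ 2
      = (eta F n K) ^ 2 *
        ∑ b ∈ Fintype.piFinset (fun i => Finset.Icc (lo i) (lo i + m)), ∑ μ,
          (if b + unitVec μ ∈ Fintype.piFinset (fun i => Finset.Icc (lo i) (lo i + m)) then
            ‖((((F.L ^ (K - n)) ^ (F.P K).d : ℕ) : ℝ) : ℂ)⁻¹ • ∑ x' ∈ Fintype.piFinset (fun i => Finset.Icc (((F.L ^ (K - n) : ℕ) : ℤ) * (b + unitVec μ) i) (((F.L ^ (K - n) : ℕ) : ℤ) * (b + unitVec μ) i + ((F.L ^ (K - n) - 1 : ℕ) : ℤ))),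
                conjR (axialFn V lo5 x') (φZ x')
              - ((((F.L ^ (K - n)) ^ (F.P K).d : ℕ) : ℝ) : ℂ)⁻¹ • ∑ x' ∈ Fintype.piFinset (fun i => Finset.Icc (((F.L ^ (K - n) : ℕ) : ℤ) * b i) (((F.L ^ (K - n) : ℕ) : ℤ) * b i + ((F.L ^ (K - n) - 1 : ℕ) : ℤ))),
                conjR (axialFn V lo5 x') (φZ x')‖ ^ 2
          else 0) := by
  classical
  have hL : 0 < F.L := by have := F.hL.2; omega
  have hℓ : 1 ≤ F.L ^ (K - n) := Nat.one_le_pow _ _ hL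
  have hbox := tiled_eq_box_of F n K lo m hzlo hzhi
  have hη : 0 < eta F n K := eta_pos F n K
  rw [Finset.sum_filter, Finset.sum_product, Finset.mul_sum]
  refine Finset.sum_congr rfl fun b hb => ?_
  rw [Finset.mul_sum]
  refine Finset.sum_congr rfl fun μ _ => ?_
  simp only [e_eq_unitVec]
  by_cases h : b + unitVec μ ∈ Fintype.piFinset (fun i => Finset.Icc (lo i) (lo i + m))
  · rw [if_pos h, if_pos h]
    have hb' := (blk_subset_tiled hℓ lo m hb).trans hbox.le
    have hbμ' := (blk_subset_tiled hℓ lo m h).trans hbox.le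
    rw [blockMean_pull_eq F n K c₀ V lo5 φ φZ hφZ _ hbμ', blockMean_pull_eq F n K c₀ V lo5 φ φZ hφZ _ hb', ← smul_sub,
      norm_smul, Real.norm_of_nonneg hη.le, mul_pow]
  · rw [if_neg h, if_neg h, mul_zero]

omit [Fact (0 < c₀)] in
/-- The block masses of the pull-back over the coarse cube add up to `η²·Σ_{box}‖φ_Z‖²`. -/
theorem sum_blocks_normSq_pull_eq {z : Zd (F.P K).d} {Rf : ℤ} (lo : Zd (F.P K).d) (m : ℕ)
    (hzlo : ∀ i, z i - Rf = ((F.L ^ (K - n) : ℕ) : ℤ) * lo i)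
    (hzhi : ∀ i, z i + Rf = ((F.L ^ (K - n) : ℕ) : ℤ) * lo i + (((m + 1) * F.L ^ (K - n) - 1 : ℕ) : ℤ))
    (φ : SiteL2K ℂ 3 (periodsT3 F K) c₀ W₂) (φZ : Zd (F.P K).d → Matrix (Fin 2) (Fin 2) ℂ)
    (hφZ : ∀ w ∈ box z Rf, (toL2S F K c₀).symm φ (transl (basePt F n K) w) = (eta F n K) • φZ w) :
    ∑ b ∈ Fintype.piFinset (fun i => Finset.Icc (lo i) (lo i + m)),
        ∑ x ∈ blockIter (F.P K).L (K - n) b, ‖(toL2S F K c₀).symm φ (transl (basePt F n K) x)‖ ^ 2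
      = (eta F n K) ^ 2 * ∑ w ∈ box z Rf, ‖φZ w‖ ^ 2 := by
  classical
  have hL : 0 < F.L := by have := F.hL.2; omega
  have hℓ : 1 ≤ F.L ^ (K - n) := Nat.one_le_pow _ _ hL
  have hη : 0 < eta F n K := eta_pos F n K
  simp only [blockIter_eq_blk]
  rw [← sum_tiled_eq_sum_blocks hℓ lo m, tiled_eq_box_of F n K lo m hzlo hzhi, Finset.mul_sum]
  refine Finset.sum_congr rfl fun w hw => ?_
  rw [hφZ w hw, norm_smul, Real.norm_of_nonneg hη.le, mul_pow]

omit [Fact (0 < c₀)] in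
/-- Multiplicity `d`: the source-block masses over the inner coarse bonds. -/
theorem sum_C_src_le {z : Zd (F.P K).d} {Rf : ℤ} (lo : Zd (F.P K).d) (m : ℕ)
    (hzlo : ∀ i, z i - Rf = ((F.L ^ (K - n) : ℕ) : ℤ) * lo i)
    (hzhi : ∀ i, z i + Rf = ((F.L ^ (K - n) : ℕ) : ℤ) * lo i + (((m + 1) * F.L ^ (K - n) - 1 : ℕ) : ℤ))
    (φ : SiteL2K ℂ 3 (periodsT3 F K) c₀ W₂) (φZ : Zd (F.P K).d → Matrix (Fin 2) (Fin 2) ℂ)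
    (hφZ : ∀ w ∈ box z Rf, (toL2S F K c₀).symm φ (transl (basePt F n K) w) = (eta F n K) • φZ w) :
    ∑ q ∈ ((Fintype.piFinset (fun i => Finset.Icc (lo i) (lo i + m))) ×ˢ (Finset.univ : Finset (Fin (F.P K).d))).filter
        (fun q => q.1 + e q.2 ∈ Fintype.piFinset (fun i => Finset.Icc (lo i) (lo i + m))),
      ∑ x ∈ blockIter (F.P K).L (K - n) q.1, ‖(toL2S F K c₀).symm φ (transl (basePt F n K) x)‖ ^ 2
      ≤ ((F.P K).d : ℝ) * ((eta F n K) ^ 2 * ∑ w ∈ box z Rf, ‖φZ w‖ ^ 2) := by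
  classical
  rw [← sum_blocks_normSq_pull_eq F n K c₀ lo m hzlo hzhi φ φZ hφZ]
  refine (Finset.sum_le_sum_of_subset_of_nonneg (Finset.filter_subset _ _) fun q _ _ => by positivity).trans ?_
  rw [Finset.sum_product, Finset.mul_sum]
  refine Finset.sum_le_sum fun b _ => ?_
  dsimp only
  rw [Finset.sum_const, Finset.card_univ, Fintype.card_fin, nsmul_eq_mul]

omit [Fact (0 < c₀)] in
/-- Multiplicity `d`: the target-block masses over the inner coarse bonds. -/
theorem sum_C_tgt_le {z : Zd (F.P K).d} {Rf : ℤ} (lo : Zd (F.P K).d) (m : ℕ)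
    (hzlo : ∀ i, z i - Rf = ((F.L ^ (K - n) : ℕ) : ℤ) * lo i)
    (hzhi : ∀ i, z i + Rf = ((F.L ^ (K - n) : ℕ) : ℤ) * lo i + (((m + 1) * F.L ^ (K - n) - 1 : ℕ) : ℤ))
    (φ : SiteL2K ℂ 3 (periodsT3 F K) c₀ W₂) (φZ : Zd (F.P K).d → Matrix (Fin 2) (Fin 2) ℂ)
    (hφZ : ∀ w ∈ box z Rf, (toL2S F K c₀).symm φ (transl (basePt F n K) w) = (eta F n K) • φZ w) :
    ∑ q ∈ ((Fintype.piFinset (fun i => Finset.Icc (lo i) (lo i + m))) ×ˢ (Finset.univ : Finset (Fin (F.P K).d))).filter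
        (fun q => q.1 + e q.2 ∈ Fintype.piFinset (fun i => Finset.Icc (lo i) (lo i + m))),
      ∑ x ∈ blockIter (F.P K).L (K - n) (q.1 + e q.2), ‖(toL2S F K c₀).symm φ (transl (basePt F n K) x)‖ ^ 2
      ≤ ((F.P K).d : ℝ) * ((eta F n K) ^ 2 * ∑ w ∈ box z Rf, ‖φZ w‖ ^ 2) := by
  classical
  rw [← sum_blocks_normSq_pull_eq F n K c₀ lo m hzlo hzhi φ φZ hφZ]
  have hg : ∀ b : Zd (F.P K).d, 0 ≤ ∑ x ∈ blockIter (F.P K).L (K - n) b, ‖(toL2S F K c₀).symm φ (transl (basePt F n K) x)‖ ^ 2 :=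
    fun b => Finset.sum_nonneg fun x _ => by positivity
  rw [Finset.sum_filter, Finset.sum_product, Finset.sum_comm]
  have hd : ((F.P K).d : ℝ) * ∑ b ∈ Fintype.piFinset (fun i => Finset.Icc (lo i) (lo i + m)),
      ∑ x ∈ blockIter (F.P K).L (K - n) b, ‖(toL2S F K c₀).symm φ (transl (basePt F n K) x)‖ ^ 2
      = ∑ μ : Fin (F.P K).d, ∑ b ∈ Fintype.piFinset (fun i => Finset.Icc (lo i) (lo i + m)),
          ∑ x ∈ blockIter (F.P K).L (K - n) b, ‖(toL2S F K c₀).symm φ (transl (basePt F n K) x)‖ ^ 2 := by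
    rw [Finset.sum_const, Finset.card_univ, Fintype.card_fin, nsmul_eq_mul]
  rw [hd]
  refine Finset.sum_le_sum fun μ _ => ?_
  rw [← Finset.sum_filter]
  calc ∑ b ∈ (Fintype.piFinset (fun i => Finset.Icc (lo i) (lo i + m))).filter
          (fun b => b + e μ ∈ Fintype.piFinset (fun i => Finset.Icc (lo i) (lo i + m))),
        ∑ x ∈ blockIter (F.P K).L (K - n) (b + e μ), ‖(toL2S F K c₀).symm φ (transl (basePt F n K) x)‖ ^ 2
      = ∑ b' ∈ ((Fintype.piFinset (fun i => Finset.Icc (lo i) (lo i + m))).filter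
          (fun b => b + e μ ∈ Fintype.piFinset (fun i => Finset.Icc (lo i) (lo i + m)))).image (fun b => b + e μ),
        ∑ x ∈ blockIter (F.P K).L (K - n) b', ‖(toL2S F K c₀).symm φ (transl (basePt F n K) x)‖ ^ 2 := by
          rw [Finset.sum_image fun b₁ _ b₂ _ h => add_left_injective (e μ) h]
    _ ≤ _ := Finset.sum_le_sum_of_subset_of_nonneg (fun b' hb' => by
          obtain ⟨b, hb, rfl⟩ := Finset.mem_image.mp hb'
          exact (Finset.mem_filter.mp hb).2) fun b _ _ => hg b


/-! ## §2 The coarse sum on the torus -/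

omit [Fact (0 < c₀)] in
/-- ★★ **THE `ℤ³` COARSE SUM READ ON THE TORUS**: with `ĉ_q := ⟨transl 0 q.1, q.2⟩` (injective on the coarse cube as soon as `m + 1 ≤ N_{K−n}`),
`Σ_{q ∈ C}‖Ad(T♯ q)(Q′_kφ♭)(q.1 + e_{q.2}) − (Q′_kφ♭)(q.1)‖² = Σ_{ĉ ∈ ι(C)}‖Ad(T ĉ)(Q′φ)(ĉ₊) − (Q′φ)(ĉ.src)‖²` with `Q′φ := QprimeCombL2 W φ`
(✓`QprimeIter_pullS_eq_apply_tcls`, ✓`shift_transl_eq`, ✓`transl_zero_eq_tcls`, ✓`transl_eq_transl_iff`). -/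
theorem sum_C_normSq_combDiff_eq (hnK : n ≤ K) (W : GaugeField (F.P K) 0 (Matrix.specialUnitaryGroup (Fin 2) ℂ))
    (T : PBond (F.P K) (K - n) → (Matrix (Fin 2) (Fin 2) ℂ)ˣ) (lo : Zd (F.P K).d) (m : ℕ)
    (hm : (m : ℤ) + 1 ≤ ((F.P K).sitesPerDir (K - n) : ℤ)) (φ : SiteL2K ℂ 3 (periodsT3 F K) c₀ W₂) :
    ∑ q ∈ ((Fintype.piFinset (fun i => Finset.Icc (lo i) (lo i + m))) ×ˢ (Finset.univ : Finset (Fin (F.P K).d))).filter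
        (fun q => q.1 + e q.2 ∈ Fintype.piFinset (fun i => Finset.Icc (lo i) (lo i + m))),
      ‖conjR (pull T 0 q.1 q.2)
          (QprimeIter (zdBlocking (F.P K).d (F.P K).L) (bgT (F.P K).L (pull (bgUnits F K W) (basePt F n K))) (K - n)
            (fun x => (toL2S F K c₀).symm φ (transl (basePt F n K) x)) (q.1 + e q.2))
        - QprimeIter (zdBlocking (F.P K).d (F.P K).L) (bgT (F.P K).L (pull (bgUnits F K W) (basePt F n K))) (K - n)
            (fun x => (toL2S F K c₀).symm φ (transl (basePt F n K) x)) q.1‖ ^ 2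
      = ∑ ĉ ∈ (((Fintype.piFinset (fun i => Finset.Icc (lo i) (lo i + m))) ×ˢ (Finset.univ : Finset (Fin (F.P K).d))).filter
          (fun q => q.1 + e q.2 ∈ Fintype.piFinset (fun i => Finset.Icc (lo i) (lo i + m)))).image
          (fun q => (⟨transl (0 : Site (F.P K) (K - n)) q.1, q.2⟩ : PBond (F.P K) (K - n))),
        ‖conjR (T ĉ) (QprimeCombL2 F n K c₀ W φ (ĉ.src.shift ĉ.dir)) - QprimeCombL2 F n K c₀ W φ ĉ.src‖ ^ 2 := by
  classical
  rw [Finset.sum_image]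
  · refine Finset.sum_congr rfl fun q _ => ?_
    dsimp only
    rw [pull_apply, shift_transl_eq, transl_zero_eq_tcls, transl_zero_eq_tcls,
      QprimeIter_pullS_eq_apply_tcls hnK W φ (q.1 + e q.2), QprimeIter_pullS_eq_apply_tcls hnK W φ q.1]
  · intro q hq q' hq' h
    have h1 : transl (0 : Site (F.P K) (K - n)) q.1 = transl 0 q'.1 := congrArg PBond.src h
    have h2 : q.2 = q'.2 := congrArg PBond.dir h
    rw [transl_eq_transl_iff] at h1
    rw [Finset.mem_coe, Finset.mem_filter, Finset.mem_product] at hq hq'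
    refine Prod.ext (funext fun ν => ?_) h2
    have hb := Finset.mem_Icc.mp (Fintype.mem_piFinset.mp hq.1.1 ν)
    have hb' := Finset.mem_Icc.mp (Fintype.mem_piFinset.mp hq'.1.1 ν)
    have habs : |q'.1 ν - q.1 ν| < ((F.P K).sitesPerDir (K - n) : ℤ) := by
      rw [abs_lt]; constructor <;> omega
    linarith [Int.eq_zero_of_abs_lt_dvd (h1 ν) habs]

/-! ## §3 `h7 ⊕ h8` at the member -/

/-- ★★★ **(a′) STAGE B — `h7 ⊕ h8` AT THE MEMBER, `ℤ³` COARSE LETTERS**: the blockwise Poincaré bound of the box mass with the coarse term converted to the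
`Ū`-differences of the comb averages `Q′_k φ♭` (px5's [I-5-conv]) plus `e²`-costs. -/
theorem h7h8_core {L : ℕ} (hL : 1 < L) (hF : F.L = L) (hnK : n ≤ K) {ε : ℝ} (he : 0 < ε) (he4 : ε ≤ min (6 * C0 3)⁻¹ (c2' 3 L / 4))
    (W : GaugeField (F.P K) 0 (Matrix.specialUnitaryGroup (Fin 2) ℂ)) (hW : RegPr F n K ε W)
    {CT : ℝ} (T : PBond (F.P K) (K - n) → (Matrix (Fin 2) (Fin 2) ℂ)ˣ) (hTU1 : ∀ c, T c ∈ U1 (Matrix (Fin 2) (Fin 2) ℂ))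
    (hclose : ∀ c : PBond (F.P K) (K - n),
      ‖(T c : Matrix (Fin 2) (Fin 2) ℂ) - ((holT (unitsField (toUField W)) (transl (basePt F n K) (blockBase ((F.P K).L ^ (K - n)) (tlift c.src)))
          (List.replicate ((F.P K).L ^ (K - n)) (c.dir, true)) : (Matrix (Fin 2) (Fin 2) ℂ)ˣ) : Matrix (Fin 2) (Fin 2) ℂ)‖ ≤ CT * ε)
    {z : Zd (F.P K).d} {Rf : ℤ} (hRN : 2 * Rf + 1 ≤ ((F.P K).sitesPerDir 0 : ℤ)) (lo : Zd (F.P K).d) (m : ℕ)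
    (hzlo : ∀ i, z i - Rf = ((F.L ^ (K - n) : ℕ) : ℤ) * lo i)
    (hzhi : ∀ i, z i + Rf = ((F.L ^ (K - n) : ℕ) : ℤ) * lo i + (((m + 1) * F.L ^ (K - n) - 1 : ℕ) : ℤ))
    (V : Zd (F.P K).d → Fin (F.P K).d → (Matrix (Fin 2) (Fin 2) ℂ)ˣ) (hV : ∀ w μ, V w μ = unitsField (toUField W) ⟨transl (basePt F n K) w, μ⟩)
    {α : ℝ} (hα : 0 ≤ α) (hP : B8Lemma1NonAbelian.PlaqSmall V (fun i => z i - Rf) (fun i => z i + Rf) α)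
    (φ : SiteL2K ℂ 3 (periodsT3 F K) c₀ W₂) (φZ : Zd (F.P K).d → Matrix (Fin 2) (Fin 2) ℂ)
    (hφZ : ∀ w ∈ box z Rf, (toL2S F K c₀).symm φ (transl (basePt F n K) w) = (eta F n K) • φZ w)
    (hD : ∀ w ∈ box z Rf, ∀ μ, w + unitVec μ ∈ box z Rf →
      (toL2 F K c₀).symm (DL2 F n K c₀ W φ) ⟨transl (basePt F n K) w, μ⟩ = conjR (V w μ) (φZ (w + unitVec μ)) - φZ w)
    (h0 : ∑ w ∈ box z Rf, conjR (axialFn V (fun i => z i - Rf) w) (φZ w) = 0) :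
    c₀ * ∑ w ∈ box z Rf, ∑ j : Fin 2, ∑ k : Fin 2, ‖((toL2S F K c₀).symm φ (transl (basePt F n K) w)) j k‖ ^ 2
      ≤ 8 * ‖DL2 F n K c₀ W φ‖ ^ 2
        + 32 * ((F.L : ℝ) ^ (K - n)) ^ 2 * (2 * ((F.P K).d : ℝ) * Rf * α) ^ 2 * ((F.P K).d : ℝ) * ‖φ‖ ^ 2
        + 32 * ((m : ℝ) * (m + 1) / 2) *
            (c₀ * ((((F.L ^ (K - n)) ^ (F.P K).d : ℕ) : ℝ)) *
              ∑ q ∈ ((Fintype.piFinset (fun i => Finset.Icc (lo i) (lo i + m))) ×ˢ (Finset.univ : Finset (Fin (F.P K).d))).filter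
                  (fun q => q.1 + e q.2 ∈ Fintype.piFinset (fun i => Finset.Icc (lo i) (lo i + m))),
                ‖conjR (pull T 0 q.1 q.2)
                    (QprimeIter (zdBlocking (F.P K).d (F.P K).L) (bgT (F.P K).L (pull (bgUnits F K W) (basePt F n K))) (K - n)
                      (fun x => (toL2S F K c₀).symm φ (transl (basePt F n K) x)) (q.1 + e q.2))
                  - QprimeIter (zdBlocking (F.P K).d (F.P K).L) (bgT (F.P K).L (pull (bgUnits F K W) (basePt F n K))) (K - n)
                      (fun x => (toL2S F K c₀).symm φ (transl (basePt F n K) x)) q.1‖ ^ 2)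
        + 64 * ((m : ℝ) * (m + 1) / 2) * ((F.P K).d : ℝ) *
            (((2 * CT + 48 * ((m + 1 : ℕ) : ℝ) + 29232) * ε) ^ 2 + ((29232 + 36 * ((m + 1 : ℕ) : ℝ)) * ε) ^ 2) * ‖φ‖ ^ 2 := by
  classical
  have hc : 0 < c₀ := Fact.out
  have hL0 : 0 < F.L := by have := F.hL.2; omega
  have hℓ : 1 ≤ F.L ^ (K - n) := Nat.one_le_pow _ _ hL0
  have hη : 0 < eta F n K := eta_pos F n K
  -- the pull-back connection IS `pull (bgUnits W) basePt`
  have hVeq : V = pull (bgUnits F K W) (basePt F n K) := funext fun w => funext fun μ => hV w μ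
  subst hVeq
  have hbox := tiled_eq_box_of F n K lo m hzlo hzhi
  -- stage A
  have hA := knitA F n K c₀ W (basePt F n K) hRN lo m hbox _ (fun w μ => rfl) hα hP φ φZ hφZ hD h0
  -- the currency identity and the conversion row (px5)
  have hY := sum_normSq_axialDiff_eq F n K c₀ (pull (bgUnits F K W) (basePt F n K)) (fun i => z i - Rf) lo m hzlo hzhi φ φZ hφZ
  have hC' : ∀ q ∈ ((Fintype.piFinset (fun i => Finset.Icc (lo i) (lo i + m))) ×ˢ (Finset.univ : Finset (Fin (F.P K).d))).filter
        (fun q => q.1 + e q.2 ∈ Fintype.piFinset (fun i => Finset.Icc (lo i) (lo i + m))),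
      (fun i => z i - Rf) ≤ blockBase ((F.P K).L ^ (K - n)) q.1 ∧
      (∀ x ∈ blockIter (F.P K).L (K - n) q.1, ∀ i, x i - (fun i => z i - Rf) i ≤ (((m + 1) * (F.P K).L ^ (K - n) : ℕ) : ℤ)) ∧
      (∀ x ∈ blockIter (F.P K).L (K - n) (q.1 + e q.2), ∀ i, x i - (fun i => z i - Rf) i ≤ (((m + 1) * (F.P K).L ^ (K - n) : ℕ) : ℤ)) := by
    intro q hq
    rw [Finset.mem_filter, Finset.mem_product] at hq
    obtain ⟨⟨hq1, -⟩, hq2⟩ := hq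
    have hℓ0 : (0 : ℤ) ≤ ((F.L ^ (K - n) : ℕ) : ℤ) := by positivity
    have hcast : (((m + 1) * (F.P K).L ^ (K - n) : ℕ) : ℤ) = ((m : ℤ) + 1) * ((F.L ^ (K - n) : ℕ) : ℤ) := by
      rw [show (F.P K).L = F.L from rfl]; push_cast; ring
    have hcast1 : ((F.L ^ (K - n) - 1 : ℕ) : ℤ) = ((F.L ^ (K - n) : ℕ) : ℤ) - 1 := by rw [Nat.cast_sub hℓ]; simp
    have height : ∀ b ∈ Fintype.piFinset (fun i => Finset.Icc (lo i) (lo i + m)),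
        ∀ x ∈ blockIter (F.P K).L (K - n) b, ∀ i, x i - (fun i => z i - Rf) i ≤ (((m + 1) * (F.P K).L ^ (K - n) : ℕ) : ℤ) := by
      intro b hb x hx i
      rw [blockIter_eq_blk] at hx
      have h1 := (Finset.mem_Icc.mp (Fintype.mem_piFinset.mp hx i)).2
      have h2 := (Finset.mem_Icc.mp (Fintype.mem_piFinset.mp hb i)).2
      have h3 : ((F.L ^ (K - n) : ℕ) : ℤ) * b i ≤ ((F.L ^ (K - n) : ℕ) : ℤ) * (lo i + m) := mul_le_mul_of_nonneg_left h2 hℓ0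
      show x i - (z i - Rf) ≤ _
      rw [hzlo i, hcast, hcast1] at *
      nlinarith
    refine ⟨fun i => ?_, height q.1 hq1, height (q.1 + e q.2) hq2⟩
    show z i - Rf ≤ (((F.P K).L ^ (K - n) : ℕ) : ℤ) * q.1 i
    rw [hzlo i, show (F.P K).L = F.L from rfl]
    exact mul_le_mul_of_nonneg_left (Finset.mem_Icc.mp (Fintype.mem_piFinset.mp hq1 i)).1 hℓ0
  have hconv := (sum_sq_grad_conv_of_regPr F n K hL hF hnK he he4 hW T hTU1 hclose (fun i => z i - Rf) (m + 1) _ hC'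
    (fun x => (toL2S F K c₀).symm φ (transl (basePt F n K) x))).2
  have hS1 := sum_C_tgt_le F n K c₀ lo m hzlo hzhi φ φZ hφZ
  have hS2 := sum_C_src_le F n K c₀ lo m hzlo hzhi φ φZ hφZ
  have hCrow := eta_sq_sum_opNorm_sq_le_norm_sq F n K c₀ (basePt F n K) hRN φ φZ hφZ (box z Rf) (Finset.Subset.refl _)
  have hω := weight_eq F n K
  have hℓd : (0 : ℝ) < ((((F.L ^ (K - n)) ^ (F.P K).d : ℕ) : ℝ)) := by positivity
  have hd0 : (0 : ℝ) ≤ ((F.P K).d : ℝ) := Nat.cast_nonneg _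
  have hcm : (0 : ℝ) ≤ (m : ℝ) * (m + 1) / 2 := by positivity
  exact knitB_arith hc.le hcm hℓd hd0 hA hY hω hconv hS1 hS2 hCrow

/-- ★★★ **(a′) `h7 ⊕ h8` AT THE MEMBER — THE BLOCKWISE POINCARÉ BOUND OF THE BOX MASS, COARSE TERM IN THE TORUS LETTERS OF `patch_budget`**:
for the box `box z R_f` of the base chart `basePt` tiled by the `(m+1)^3` comb blocks `b ∈ lo + [0,m]^3` (`z − R_f = ℓ·lo`, `z + R_f = ℓ·lo + (m+1)ℓ − 1`), the local
potential `φ` of (B8-member) with chart function `φ_Z` (rows `hφZ`, `hD`, normalisation (0)), the box pull-back `V` with `PlaqSmall V (z−R_f) (z+R_f) α`, and any unit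
coarse transporter `T` with the (B3c) rider:
`Φt ≤ 8·‖D_Wφ‖² + 32ℓ²(2dR_fα)²d·‖φ‖² + 32·c_m·(c₀ℓ^d·Σ_{ĉ ∈ ι(C)}‖Ad(T ĉ)(Q′φ)(ĉ₊) − (Q′φ)(ĉ.src)‖²) + 64·c_m·d·(γ′² + γ²)·‖φ‖²`,
`Φt := c₀Σ_{w ∈ box}hs(φ♭(basePt + w))`, `c_m = m(m+1)∕2`, `γ′ = (2CT + 48(m+1) + 29232)ε`, `γ = (29232 + 36(m+1))ε`, `Q′φ := QprimeCombL2 W φ`, `ι(C)` = the torus images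
`⟨transl 0 b, μ⟩` of the inner coarse bonds of the cube (`8` is `R`- and `K`-free; with `α = e·η²` (P-box) the second term is `≤ 55296·R²·e²·‖φ‖²`).
[cite: Balaban1985Averaging, pp.24-25; Balaban1985BackgroundPropagators, (3.19) p.393, (3.100) p.413] -/
theorem h7h8_member {L : ℕ} (hL : 1 < L) (hF : F.L = L) (hnK : n ≤ K) {ε : ℝ} (he : 0 < ε) (he4 : ε ≤ min (6 * C0 3)⁻¹ (c2' 3 L / 4))
    (W : GaugeField (F.P K) 0 (Matrix.specialUnitaryGroup (Fin 2) ℂ)) (hW : RegPr F n K ε W)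
    {CT : ℝ} (T : PBond (F.P K) (K - n) → (Matrix (Fin 2) (Fin 2) ℂ)ˣ) (hTU1 : ∀ c, T c ∈ U1 (Matrix (Fin 2) (Fin 2) ℂ))
    (hclose : ∀ c : PBond (F.P K) (K - n),
      ‖(T c : Matrix (Fin 2) (Fin 2) ℂ) - ((holT (unitsField (toUField W)) (transl (basePt F n K) (blockBase ((F.P K).L ^ (K - n)) (tlift c.src)))
          (List.replicate ((F.P K).L ^ (K - n)) (c.dir, true)) : (Matrix (Fin 2) (Fin 2) ℂ)ˣ) : Matrix (Fin 2) (Fin 2) ℂ)‖ ≤ CT * ε)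
    {z : Zd (F.P K).d} {Rf : ℤ} (hRN : 2 * Rf + 1 ≤ ((F.P K).sitesPerDir 0 : ℤ)) (lo : Zd (F.P K).d) (m : ℕ)
    (hzlo : ∀ i, z i - Rf = ((F.L ^ (K - n) : ℕ) : ℤ) * lo i)
    (hzhi : ∀ i, z i + Rf = ((F.L ^ (K - n) : ℕ) : ℤ) * lo i + (((m + 1) * F.L ^ (K - n) - 1 : ℕ) : ℤ))
    (V : Zd (F.P K).d → Fin (F.P K).d → (Matrix (Fin 2) (Fin 2) ℂ)ˣ) (hV : ∀ w μ, V w μ = unitsField (toUField W) ⟨transl (basePt F n K) w, μ⟩)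
    {α : ℝ} (hα : 0 ≤ α) (hP : B8Lemma1NonAbelian.PlaqSmall V (fun i => z i - Rf) (fun i => z i + Rf) α)
    (φ : SiteL2K ℂ 3 (periodsT3 F K) c₀ W₂) (φZ : Zd (F.P K).d → Matrix (Fin 2) (Fin 2) ℂ)
    (hφZ : ∀ w ∈ box z Rf, (toL2S F K c₀).symm φ (transl (basePt F n K) w) = (eta F n K) • φZ w)
    (hD : ∀ w ∈ box z Rf, ∀ μ, w + unitVec μ ∈ box z Rf →
      (toL2 F K c₀).symm (DL2 F n K c₀ W φ) ⟨transl (basePt F n K) w, μ⟩ = conjR (V w μ) (φZ (w + unitVec μ)) - φZ w)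
    (h0 : ∑ w ∈ box z Rf, conjR (axialFn V (fun i => z i - Rf) w) (φZ w) = 0) :
    c₀ * ∑ w ∈ box z Rf, ∑ j : Fin 2, ∑ k : Fin 2, ‖((toL2S F K c₀).symm φ (transl (basePt F n K) w)) j k‖ ^ 2
      ≤ 8 * ‖DL2 F n K c₀ W φ‖ ^ 2
        + 32 * ((F.L : ℝ) ^ (K - n)) ^ 2 * (2 * ((F.P K).d : ℝ) * Rf * α) ^ 2 * ((F.P K).d : ℝ) * ‖φ‖ ^ 2
        + 32 * ((m : ℝ) * (m + 1) / 2) *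
            (c₀ * ((((F.L ^ (K - n)) ^ (F.P K).d : ℕ) : ℝ)) *
              ∑ ĉ ∈ (((Fintype.piFinset (fun i => Finset.Icc (lo i) (lo i + m))) ×ˢ (Finset.univ : Finset (Fin (F.P K).d))).filter
                  (fun q => q.1 + e q.2 ∈ Fintype.piFinset (fun i => Finset.Icc (lo i) (lo i + m)))).image
                  (fun q => (⟨transl (0 : Site (F.P K) (K - n)) q.1, q.2⟩ : PBond (F.P K) (K - n))),
                ‖conjR (T ĉ) (QprimeCombL2 F n K c₀ W φ (ĉ.src.shift ĉ.dir)) - QprimeCombL2 F n K c₀ W φ ĉ.src‖ ^ 2)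
        + 64 * ((m : ℝ) * (m + 1) / 2) * ((F.P K).d : ℝ) *
            (((2 * CT + 48 * ((m + 1 : ℕ) : ℝ) + 29232) * ε) ^ 2 + ((29232 + 36 * ((m + 1 : ℕ) : ℝ)) * ε) ^ 2) * ‖φ‖ ^ 2 := by
  have hd : 0 < (F.P K).d := by rw [T3Family.P_d]; norm_num
  have hm := succ_le_sitesPerDir_of F n K hnK hRN lo m ⟨0, hd⟩ (hzlo _) (hzhi _)
  rw [← sum_C_normSq_combDiff_eq F n K c₀ hnK W T lo m hm φ]
  exact h7h8_core F n K c₀ hL hF hnK he he4 W hW T hTU1 hclose hRN lo m hzlo hzhi V hV hα hP φ φZ hφZ hD h0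

end Summit.QuantumFields.YangMills.Theorems.Prop7TiledCubeMemberH7H8
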